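import Summits.FinalStateConjecture.FinalStateConjecture.Theorems.StarvedNecksHonestFixedRadiusSettlingTSingleDevelopment
import Summits.FinalStateConjecture.FinalStateConjecture.Theorems.UniversalWitnessFamily.Negative.MinkowskiSettled
import Summits.FinalStateConjecture.FinalStateConjecture.Theorems.StarvedNecksHonestFixedRadiusSettlingTStubSettledRaysHelpers
import Literature.Geometry.Lorentzian.CompleteDevelopmentMaximal
import HarnessLib

/-!
# Crux `StarvedNecks.HonestFixedRadiusSettlingT` (stmt-FinalStateConjecture-17575), line `Sketch` —
# the TRIVIAL FIBRE of `T`, decided modulo maximality of Minkowski space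

Sequel of `…TSingleDevelopment` (transport of `settledT` along isometries of developments). On the one
admissible datum the tree certifies, `(ℝ³, δ, 0)`:

* `exists_honest_minkowskiDecomp` — the honest `N = 0` identity-chart `C⁴` decomposition of `{x⁰ ≥ 0} ⊆ ℝ⁴`
  (charted region `{x⁰ > 0}`, `HonestCore`, `HonestFar` at `R₀ = 0`, vacuous distinct velocities);
* `minkowski_mem_settledT` — the Minkowski development of the trivial datum is `T`-settled (complete `𝓘⁺`,
  `O = {x⁰ ≥ 0} = exteriorOf`, rays from the slice stay in `J⁺(ι ℝ³) = O`);
* `mem_settledT_of_isMaximal_trivialData` — hence EVERY maximal development of the trivial datum is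
  `T`-settled, UNCONDITIONALLY (each is isometric to Minkowski space,
  `Minkowski.isIsometricTo_vacuumCauchyDevelopment_of_isMaximal`, and `settledT` is transported);
* `PT_trivialData_iff_isMaximal_minkowski` — **the trivial fibre of `T` is decided modulo exactly one
  statement**: `P_T (ℝ³, δ, 0) ↔ Minkowski.vacuumCauchyDevelopment.IsMaximal` (⇐ the Choquet-Bruhat–Geroch
  existence fact, `PT_trivialData_of_cbg`); i.e. the trivial datum is `T`-exceptional iff Minkowski space
  fails to be a maximal development of its own slice (`trivialData_exceptional_iff`).

Everything is proved; Mathlib + landed tree modules only; no definitions (the decomposition is an `∃`).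

## References

* D. Christodoulou, S. Klainerman, *The global nonlinear stability of the Minkowski space* (1993),
  Thm. 1.0.2 (Minkowski space is its own final state).
* H. Ringström, *The Cauchy Problem in General Relativity* (2009), Ch. 16, Thm. 16.6 (Minkowski as MGHD).
* Y. Choquet-Bruhat, R. Geroch, Comm. Math. Phys. 14 (1969) 329–335, Thm. 3.
* D. Christodoulou, CQG 16 (1999) A23, pp. A26–A27 (complete `𝓘⁺`).
* B. O'Neill, *Semi-Riemannian geometry* (1983), Ch. 14 pp. 402–403.
-/

-- every `Summit.FinalStateConjecture.FinalStateConjecture.…` name repeats the summit = sub-problem segment (D-0017 layout)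
set_option linter.dupNamespace false

noncomputable section

open scoped Manifold ContDiff Topology
open Set Filter TopologicalSpace Function

namespace Summit.FinalStateConjecture.FinalStateConjecture.Theorems.StarvedNecks.TrivialFibre

open Literature.Geometry.Lorentzian
open Summit.FinalStateConjecture (HasCompleteNullInfinity exteriorOf RaysStayInClosure)
open Summit.FinalStateConjecture.FinalStateConjecture.Theorems.HonestFixedRadiusSettling.Negative
  (honestCoreSet honestFarSet mem_honestCoreSet_iff_of_N_eq_zero mem_honestFarSet_iff_of_N_eq_zero)
open Summit.FinalStateConjecture.FinalStateConjecture.Theorems.HonestFixedRadiusSettlingT.Negative.FlatClass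
  (velocitySet settledT)
open Summit.FinalStateConjecture.FinalStateConjecture.Theorems.StarvedNecks.SingleDevelopment
  (settledT_of_isIsometricTo)
open Summit.FinalStateConjecture.FinalStateConjecture.Theorems.UniversalWitnessFamily.Negative
  (minkowskiExterior idFlatChart image_idFlatChart_lateRegion image_idFlatChart_timeSlab
    deviationExtend_idFlatChart isLateChart_idFlatChart causalFuture_range_sliceEmbed chronologicalPast_late)
open Summit.FinalStateConjecture.FinalStateConjecture.Theorems.WeakCosmicCensorshipMGHD.Negative
  (minkowski_hasCompleteNullInfinity)
open Summit.FinalStateConjecture.FinalStateConjecture.Theorems.StarvedNecks.SettledRays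
  (ray_mem_causalFuture_of_le)

/-! ### §4 The trivial fibre: Minkowski space is `T`-settled; every MGHD of `(ℝ³, δ, 0)` is -/

section MinkowskiModel

open Literature.Geometry.Lorentzian.Minkowski

/-- **The honest `N = 0` final-state decomposition of `O = {x⁰ ≥ 0} ⊆ ℝ⁴` at order `4`** by the identity
flat chart of Minkowski spacetime (the construction of `UniversalWitnessFamily.Negative.minkowskiDecomp` with
`2 ↦ 4`: the deviation vanishes identically, so every order is free), with charted region `{x⁰ > 0}`, in
`honestCoreSet ∩ honestFarSet` at `R₀ = 0` (no hole; the push-forward of `∂₀` under the inclusion `⊤ ↪ ℝ⁴` is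
`∂ₜ`; flat-late points lie below later flat slabs along vertical segments; late flat slabs `{x⁰ ≥ τ'}` are
closed) and, vacuously, in `velocitySet`. Christodoulou–Klainerman 1993, Thm. 1.0.2 (Minkowski space is its
own final state). [cite: ChristodoulouKlainerman1993, Thm. 1.0.2] -/
theorem exists_honest_minkowskiDecomp :
    ∃ d : FinalStateDecomposition Minkowski.spacetime minkowskiExterior 4,
      d.charted = {x : E4 | 0 < x 0} ∧
        d ∈ honestCoreSet Minkowski.spacetime minkowskiExterior 4 0 ∧
          d ∈ honestFarSet Minkowski.spacetime minkowskiExterior 4 0 ∧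
            d ∈ velocitySet Minkowski.spacetime minkowskiExterior 4 := by
  let d : FinalStateDecomposition Minkowski.spacetime minkowskiExterior 4 :=
    { N := 0
      mass := Fin.elim0
      spin := Fin.elim0
      mass_pos := fun i ↦ i.elim0
      abs_spin_le_mass := fun i ↦ i.elim0
      motion := Fin.elim0
      τ₀ := 0
      chart := fun i ↦ i.elim0
      isLateChart := fun i ↦ i.elim0
      tendsto_truncDeviationCk := fun i ↦ i.elim0
      exists_pairwise_disjoint := fun _ ↦ ⟨0, fun i ↦ i.elim0⟩
      excision := Fin.elim0
      tendsto_excision_div := fun i ↦ i.elim0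
      flatDomain := ⊤
      setOf_lt_excision_subset_flatDomain := fun _ _ ↦ trivial
      flatChart := idFlatChart
      isLateChart_flat := isLateChart_idFlatChart
      tendsto_deviationCk_flat := by
        have h : ∀ τ, Minkowski.spacetime.deviationCk (Minkowski.backgroundOn ⊤) idFlatChart 4 τ = 0 :=
          fun τ ↦ by rw [Spacetime.deviationCk, deviationExtend_idFlatChart, supCkENorm_zero]
        simp_rw [h]
        exact tendsto_const_nhds
      diff_subset_causalPast := by
        intro (x : E4) hx
        have hx0 : (0 : ℝ) ≤ x 0 := hx.1
        have hxle : x 0 ≤ 0 := by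
          refine not_lt.mp fun hlt ↦ hx.2 (Or.inr ?_)
          have : x ∈ (idFlatChart '' (Minkowski.backgroundOn ⊤).lateRegion 0 : Set E4) := by
            rw [image_idFlatChart_lateRegion]; exact hlt
          exact this
        refine LorentzianMetric.subset_causalFuture _ _ _ (Or.inr ?_)
        have : x ∈ (idFlatChart '' (Minkowski.backgroundOn ⊤).timeSlab 0 : Set E4) := by
          rw [image_idFlatChart_timeSlab]; exact le_antisymm hxle hx0
        exact this }
  have hN : d.N = 0 := rfl
  refine ⟨d, ?_, ?_, ?_, fun i ↦ i.elim0⟩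
  · -- the charted region is the late flat region `{x⁰ > 0}`
    haveI : IsEmpty (Fin d.N) := Fin.isEmpty'
    rw [FinalStateDecomposition.charted, iUnion_of_empty, union_empty, FinalStateDecomposition.radiationZone]
    exact image_idFlatChart_lateRegion 0
  · -- `HonestCore`: the identity flat chart is the inclusion `⊤ ↪ E4`, whose differential is the identity
    rw [mem_honestCoreSet_iff_of_N_eq_zero _ hN]
    intro y _
    have h : mfderiv 𝓘(ℝ, E4) (𝓡 4) d.flatChart y = ContinuousLinearMap.id ℝ E4 :=
      (hasMFDerivAt_subtypeVal (I' := 𝓡 4) (W := (⊤ : Opens E4)) y).mfderiv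
    rw [h]
    exact Minkowski.spacetime.timeOrientation.isFutureDirected_vectorField (d.flatChart y)
  · -- `HonestFar`: (F1) vertical segments; (F2) the late flat slabs are closed
    rw [mem_honestFarSet_iff_of_N_eq_zero _ hN]
    refine ⟨fun τ₂ _ ↦ ?_, fun τ' _ ↦ ?_⟩
    · rintro _ ⟨y, hy, rfl⟩
      have hxle : (y : E4) 0 ≤ τ₂ := hy.2.le
      have hJ : (y : E4) ∈ Minkowski.spacetime.metric.causalPast Minkowski.spacetime.timeOrientation
          ({E4.ofTimeSpace τ₂ (E4.spatial (y : E4))} : Set E4) := by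
        refine Minkowski.mem_causalPast_vacuumCauchyDevelopment ?_
        simp only [E4.spatial_ofTimeSpace, sub_self, norm_zero, E4.ofTimeSpace_apply_zero, sub_nonneg]
        exact hxle
      refine LorentzianMetric.causalFuture_mono (M := Minkowski.spacetime.carrier) ?_ hJ
      refine singleton_subset_iff.mpr ?_
      have : E4.ofTimeSpace τ₂ (E4.spatial (y : E4)) ∈
          (idFlatChart '' (Minkowski.backgroundOn ⊤).timeSlab τ₂ : Set E4) := by
        rw [image_idFlatChart_timeSlab]; exact E4.ofTimeSpace_apply_zero τ₂ _
      exact this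
    · have hset : idFlatChart '' {y : (⊤ : Opens E4) | τ' ≤ y.1 0} = {x : E4 | τ' ≤ x 0} := by
        ext x
        constructor
        · rintro ⟨y, hy, rfl⟩
          exact hy
        · intro hx
          exact ⟨⟨x, trivial⟩, hx, rfl⟩
      show closure (idFlatChart '' {y : (⊤ : Opens E4) | τ' ≤ y.1 0}) ⊆
        idFlatChart '' {y : (⊤ : Opens E4) | τ' ≤ y.1 0}
      rw [hset]
      exact (isClosed_le continuous_const (PiLp.continuous_apply 2 _ 0)).closure_subset

/-- **`J⁺(ι ℝ³) = {x⁰ ≥ 0}` is the self-determined exterior of any decomposition charted on `{x⁰ > 0}`** in the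
Minkowski development of the trivial datum (`J⁺({x⁰ = 0}) = {x⁰ ≥ 0}`, `I⁻({x⁰ > 0}) = ℝ⁴`).
[cite: DafermosLuk2017, Conjecture 1] -/
theorem minkowskiExterior_eq_exteriorOf_of_charted_eq
    {d : FinalStateDecomposition Minkowski.spacetime minkowskiExterior 4} (hd : d.charted = {x : E4 | 0 < x 0}) :
    minkowskiExterior = exteriorOf Minkowski.vacuumCauchyDevelopment.toCauchyDevelopment d.charted := by
  change minkowskiExterior = Minkowski.spacetime.metric.causalFuture Minkowski.spacetime.timeOrientation
      (range Minkowski.sliceEmbed) ∩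
    Minkowski.spacetime.metric.chronologicalPast Minkowski.spacetime.timeOrientation d.charted
  rw [hd]
  refine Set.ext fun (x : E4) ↦ ⟨fun hx ↦ ⟨?_, ?_⟩, fun hx ↦ ?_⟩
  · exact (Set.ext_iff.mp causalFuture_range_sliceEmbed x).mpr hx
  · exact (Set.ext_iff.mp (chronologicalPast_late 0) x).mpr (mem_univ x)
  · exact (Set.ext_iff.mp causalFuture_range_sliceEmbed x).mp hx.1

/-- **The rays clause on the model: every normalised null ray from the slice stays in `{x⁰ ≥ 0}`.** A ray
point `γ t`, `t ≥ 0`, lies in `J⁺(γ 0) = J⁺(ι p) ⊆ J⁺(ι ℝ³) = {x⁰ ≥ 0}` (the ray is a future causal curve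
on its interval domain, `SettledRays.ray_mem_causalFuture_of_le`). [cite: Christodoulou1999, pp. A26–A27] -/
theorem raysStayInClosure_minkowskiExterior :
    RaysStayInClosure Minkowski.vacuumCauchyDevelopment.toCauchyDevelopment minkowskiExterior := by
  intro _inst p γ dom hγ _ t ht ht0
  refine subset_closure ?_
  rw [← causalFuture_range_sliceEmbed]
  have hJ := ray_mem_causalFuture_of_le Minkowski.vacuumCauchyDevelopment.toCauchyDevelopment hγ
    hγ.zero_mem ht ht0
  rw [hγ.apply_zero] at hJ
  have hp : Minkowski.vacuumCauchyDevelopment.embed p ∈ range Minkowski.sliceEmbed := ⟨p, rfl⟩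
  exact LorentzianMetric.causalFuture_mono (M := Minkowski.spacetime.carrier)
    (singleton_subset_iff.mpr hp) hJ

/-- **THE MODEL POINT IS `T`-SETTLED.** The Minkowski development of the trivial datum `(ℝ³, δ, 0)` lies in
`settledT trivialData`: complete `𝓘⁺` (`minkowski_hasCompleteNullInfinity`) and the honest identity-chart
`C⁴` decomposition of `O = {x⁰ ≥ 0} = exteriorOf` (`exists_honest_minkowskiDecomp`), with the rays clause,
`HonestCore`, `HonestFar` (at `R₀ = 0`) and (vacuously) distinct velocities. Christodoulou–Klainerman 1993,
Thm. 1.0.2. [cite: ChristodoulouKlainerman1993, Thm. 1.0.2] -/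
theorem minkowski_mem_settledT : Minkowski.vacuumCauchyDevelopment ∈ settledT trivialData := by
  obtain ⟨d, hd, hc, hf, hv⟩ := exists_honest_minkowskiDecomp
  exact ⟨minkowski_hasCompleteNullInfinity, minkowskiExterior, d, 0,
    minkowskiExterior_eq_exteriorOf_of_charted_eq hd, raysStayInClosure_minkowskiExterior, hc, hf, hv⟩

/-- **Every maximal development of the trivial datum is `T`-settled — unconditionally.** A maximal vacuum
Cauchy development of `(ℝ³, δ, 0)` is isometric, as a development, to Minkowski space
(`Minkowski.isIsometricTo_vacuumCauchyDevelopment_of_isMaximal`: Minkowski space is geodesically complete,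
so its embedding into the maximal development is onto), and `settledT` is transported
(`settledT_of_isIsometricTo`). [cite: Ringstrom2009, Thm. 16.6] -/
theorem mem_settledT_of_isMaximal_trivialData {𝒟 : VacuumCauchyDevelopment trivialData}
    (h𝒟 : 𝒟.IsMaximal) : 𝒟 ∈ settledT trivialData :=
  settledT_of_isIsometricTo (Minkowski.isIsometricTo_vacuumCauchyDevelopment_of_isMaximal h𝒟)
    minkowski_mem_settledT

/-- **THE TRIVIAL FIBRE OF `T` IS DECIDED MODULO EXACTLY ONE STATEMENT.** `P_T (ℝ³, δ, 0)` — an MGHD of the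
trivial datum exists and every MGHD is `T`-settled — holds iff Minkowski space is a maximal development of
its slice `{t = 0}` (the universal conjunct is free by `mem_settledT_of_isMaximal_trivialData`; the
existential one is `Minkowski.isMaximal_vacuumCauchyDevelopment_iff`). [cite: Ringstrom2009, Thm. 16.6] -/
theorem PT_trivialData_iff_isMaximal_minkowski :
    ((∃ 𝒟 : VacuumCauchyDevelopment trivialData, 𝒟.IsMaximal) ∧
        ∀ 𝒟 : VacuumCauchyDevelopment trivialData, 𝒟.IsMaximal → 𝒟 ∈ settledT trivialData) ↔
      Minkowski.vacuumCauchyDevelopment.IsMaximal := by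
  rw [Minkowski.isMaximal_vacuumCauchyDevelopment_iff]
  exact ⟨fun h ↦ h.1, fun h ↦ ⟨h, fun 𝒟 h𝒟 ↦ mem_settledT_of_isMaximal_trivialData h𝒟⟩⟩

/-- **Under the Choquet-Bruhat–Geroch existence theorem the trivial datum satisfies `P_T`** (it is NOT
`T`-exceptional): Minkowski space is then maximal (`Minkowski.isMaximal_vacuumCauchyDevelopment`).
[cite: ChoquetBruhatGeroch1969CMP, Thm. 3] -/
theorem PT_trivialData_of_cbg (hcbg : choquetBruhat_geroch_exists_mghd_cauchy) :
    (∃ 𝒟 : VacuumCauchyDevelopment trivialData, 𝒟.IsMaximal) ∧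
      ∀ 𝒟 : VacuumCauchyDevelopment trivialData, 𝒟.IsMaximal → 𝒟 ∈ settledT trivialData :=
  PT_trivialData_iff_isMaximal_minkowski.2 (Minkowski.isMaximal_vacuumCauchyDevelopment hcbg)

/-- **The trivial datum is `T`-exceptional iff Minkowski space is NOT a maximal development of its slice**
(membership in the exceptional set `{d ∈ 𝓓 | ¬ P_T d}` of the crux over `Σ = ℝ³`; the admissibility of
`(ℝ³, δ, 0)` is `trivialData_mem_admissibleVacuumData`). [cite: Ringstrom2009, Thm. 16.6] -/
theorem trivialData_exceptional_iff :
    trivialData ∈ {d ∈ admissibleVacuumData Minkowski.slice |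
        ¬ ((∃ 𝒟 : VacuumCauchyDevelopment d, 𝒟.IsMaximal) ∧
          ∀ 𝒟 : VacuumCauchyDevelopment d, 𝒟.IsMaximal → 𝒟 ∈ settledT d)} ↔
      ¬ Minkowski.vacuumCauchyDevelopment.IsMaximal := by
  rw [mem_setOf_eq, PT_trivialData_iff_isMaximal_minkowski]
  exact ⟨fun h ↦ h.2, fun h ↦ ⟨trivialData_mem_admissibleVacuumData, h⟩⟩

end MinkowskiModel

end Summit.FinalStateConjecture.FinalStateConjecture.Theorems.StarvedNecks.TrivialFibre

end
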